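import Summits.ABC.ABC.Theses.LopsidedSzpiroSplit

/-!
# Strategy census r1 companion — crux stmt-ABC-18360 `LopsidedABC` (crux-strategist r1, 2026-08-17)

Lean companion of the r1 section of `Cruxes/LopsidedABC/STRATEGY-CENSUS.md` (second opinion after
`cstrat-stmt-ABC-18360-s1`).  Sorry-free; imports only the route file.  Nothing here is an engine: the
file TYPES the archimedean content of the crux and proves the sandwich / calibration facts the census
quotes, so that the tribunal can see exactly where `LopsidedABC` (= `X`) sits.

## §A  The archimedean shadow of the crux

`ArchShadow` is the inequality, for coprime `0 < M < c`,

  `c^(1-ε) ≤ K(ε) · (c − M) · rad(M·c)^(1+ε)`,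

i.e. `λ_∞(1, M/c) = log (c/(c−M)) ≤ ε·h + (1+ε)·N^(1)_{[0]+[∞]} + O_ε(1)`: the ARCHIMEDEAN Vojta
inequality with truncated counting function for `(P¹, D = [0] + [∞])` at the rational point `M/c`
approximating `1`.  It is, verbatim, the conclusion of Pasten, *On the arithmetic case of Vojta's
conjecture with truncated counting functions* (Math. Res. Lett. 2025, arXiv:2205.07841), Lemma 5.2, which
derives it from the LANG–WALDSCHMIDT conjecture on linear forms in logarithms (ibid. Conj. 5.1).

* `archShadow_of_lopsided : LopsidedABC → ArchShadow` — the crux implies it (same `ε`);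
* `squarefreeMin_of_archShadow : ArchShadow → SquarefreeMinABC` — it ALONE gives the abc inequality
  for every abc triple whose smaller member is squarefree, in particular on the whole cell `min(a,b) = 1`
  (`MinOneABC`), which carries the extremal lopsided data (`1 + (3^(2^n) − 1) = 3^(2^n)`,
  Granville–Tucker `(1, 2ⁿ − 1, 2ⁿ)`, Reyssat-type records) and classical open problems (§C);
* hence `LopsidedABC → MinOneABC` (`minOne_of_lopsided`): the crux decides abc on `a = 1`.

What `ArchShadow` does NOT give is the crux on triples whose small member is POWERFUL: the defect in
`squarefreeMin_of_archShadow` is exactly the factor `min / rad(min)`.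

## §B  That residual cell is crux-complete

`lopsided_of_squareMinLopsided : SquareMinLopsided → LopsidedABC`: one min-breeding
`τ(a, b, c) = (a², b(a+c), c²)` (the s1 companion's `breed`) puts every lopsided triple into the cell
"min and c perfect squares" (⊂ powerful-min), preserving lopsidedness exactly and multiplying `rad` by
`≤ 2c`; so `{ArchShadow, X|powerful-min}` (census D-A) is NOT an honest decomposition — criterion (c) fails,
kernel-checked (`squareMinLopsided_iff_lopsided`).

## §D  A breeding that moves the top

`isABCTriple_rho`, `rad_rho_le`: `ρ(a,b,c) = (a², c(b−a), b²)` is an abc triple with radical `≤ rad(abc)·(b−a)`;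
it puts the old middle member on top, so `supp(c)`-profile cells are NOT breeding-invariant (sharpens s1 D3/D4).

## §E  The fixed-share ladder

`FixedShareABC s₀` (abc-quality `→ 1` on the fixed cell `min ≤ c^(1−s₀)`): `LopsidedABC ⟺ ∀ s₀>0, FixedShareABC s₀`,
monotone in `s₀`, top rung `FixedShareABC 1 ⟺ MinOneABC`.  Locates the content of the crux at the low-share end.

## §F  `ABC ⟺ LopsidedABC ∧ SexticABC`

`abc_iff_lopsided_and_sextic` (route `closes` + `sextic_of_abc`): the route's two cruxes are jointly the summit.

## §C  Calibration: the crux sits above Erdős's consecutive-powerful-numbers problem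

`erdosPowerfulTriples_finite_of_minOne : MinOneABC → {n ≥ 2 | n−1, n, n+1 all powerful}.Finite`
(triple `(1, n² − 1, n²)`, `rad ≤ n^(3/2)`, `ε = 1/7`).  With §A: `LopsidedABC →` finiteness of
powerful triples `{n−1, n, n+1}` (Erdős conjectures there are none; open).  [Hellegouarch 2000, Ex. 6.16
p. 267 for the abc version; here only the lopsided `a = 1` slice of abc is used.]
-/

-- `Summit.<Summit>.<Problem>`: for the single-conjunct summit `ABC` the duplicate `ABC.ABC` is mandated.
set_option linter.dupNamespace false

noncomputable section

namespace Summit.ABC.ABC.Cruxes.LopsidedABC.StrategistR1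

open Literature.NumberTheory.DiophantineGeometry UniqueFactorizationMonoid
open Summit.ABC.ABC.Theses.LopsidedSzpiroSplit

/-! ## §A  The archimedean shadow -/

/-- **ArchShadow** — the archimedean Vojta inequality for `(P¹, [0]+[∞])` at `M/c → 1`
(conclusion of Pasten 2025, Lemma 5.2; a consequence of the Lang–Waldschmidt conjecture):
for coprime `0 < M < c`, `c^(1-ε) ≤ K · (c − M) · rad(M c)^(1+ε)`.  Here `rad 1 M c = radical (M·c)`.
[cite: Pasten2025MRL, Lemma 5.2] -/
def ArchShadow : Prop :=
  ∀ ε : ℝ, 0 < ε → ∃ K : ℝ, 0 < K ∧ ∀ M c : ℕ, 0 < M → M < c → Nat.Coprime M c →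
    (c : ℝ) ^ (1 - ε) ≤ K * ((c - M : ℕ) : ℝ) * ((rad 1 M c : ℕ) : ℝ) ^ (1 + ε)

/-- abc on the cell "the smaller member is squarefree". -/
def SquarefreeMinABC : Prop :=
  ∀ ε : ℝ, 0 < ε → ∃ K : ℝ, 0 < K ∧ ∀ a b c : ℕ, IsABCTriple a b c → Squarefree (min a b) →
    (c : ℝ) < K * ((rad a b c : ℕ) : ℝ) ^ (1 + ε)

/-- abc on the cell `min(a,b) = 1` (the `a = 1` slice: `1 + b = c`). -/
def MinOneABC : Prop :=
  ∀ ε : ℝ, 0 < ε → ∃ K : ℝ, 0 < K ∧ ∀ a b c : ℕ, IsABCTriple a b c → min a b = 1 →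
    (c : ℝ) < K * ((rad a b c : ℕ) : ℝ) ^ (1 + ε)

/-! ### Elementary facts about `rad` -/

/-- `1 ≤ rad`. [folklore] -/
theorem one_le_rad (a b c : ℕ) : (1 : ℝ) ≤ ((rad a b c : ℕ) : ℝ) := by
  have : 0 < rad a b c := by rw [rad_def]; exact Nat.radical_pos _
  exact_mod_cast this

/-- `rad(m·M·c) ≤ m · rad(M·c)` for `m > 0`. [folklore] -/
theorem rad_le_mul_rad_one {m : ℕ} (hm : 0 < m) (M c : ℕ) : rad m M c ≤ m * rad 1 M c := by
  rw [rad_def, rad_def, one_mul, mul_assoc]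
  calc radical (m * (M * c)) ≤ radical m * radical (M * c) :=
        Nat.le_of_dvd (Nat.mul_pos (Nat.radical_pos _) (Nat.radical_pos _)) radical_mul_dvd
    _ ≤ m * radical (M * c) := Nat.mul_le_mul_right _ (Nat.radical_le_self_iff.mpr hm.ne')

/-- For an abc triple with `a` squarefree, `rad(abc) = a · rad(bc)`. [folklore] -/
theorem rad_eq_mul_rad_one_of_squarefree {a b c : ℕ} (h : IsABCTriple a b c) (ha : Squarefree a) :
    rad a b c = a * rad 1 b c := by
  obtain ⟨-, -, hsum, hcop⟩ := h
  have hac : Nat.Coprime a c := by rw [← hsum]; exact Nat.coprime_self_add_right.mpr hcop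
  have hrel : IsRelPrime a (b * c) := Nat.coprime_iff_isRelPrime.mp (Nat.Coprime.mul_right hcop hac)
  have hra : radical a = a := by
    rw [Nat.radical_eq_prod_primeFactors, Nat.prod_primeFactors_of_squarefree ha]
  rw [rad_def, rad_def, one_mul, mul_assoc, radical_mul hrel, hra]

/-- abc triples are symmetric in `a, b`. [folklore] -/
theorem isABCTriple_swap {a b c : ℕ} (h : IsABCTriple a b c) : IsABCTriple b a c := by
  obtain ⟨ha, hb, habc, hcop⟩ := h
  exact ⟨hb, ha, by omega, hcop.symm⟩

/-- `rad(bac) = rad(abc)`. [folklore] -/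
theorem rad_swap' (a b c : ℕ) : rad b a c = rad a b c := by
  rw [rad_def, rad_def, mul_comm b a]

/-! ### A1.  The crux implies its archimedean shadow -/

/-- **A1.** `LopsidedABC → ArchShadow` (same `ε`; constant `max K 1`).  For coprime `0 < M < c` put
`m = c − M`; if `m ≤ c^(1-ε)` the triple `(m, M, c)` is lopsided and the crux gives
`c < K·rad(mMc)^(1+ε) ≤ K·m^(1+ε)·rad(Mc)^(1+ε) ≤ K·m·c^ε·rad(Mc)^(1+ε)`; otherwise `c^(1-ε) < m`. [folklore] -/
theorem archShadow_of_lopsided (h : LopsidedABC) : ArchShadow := by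
  intro ε hε
  obtain ⟨K, hK, hh⟩ := h ε hε
  refine ⟨max K 1, lt_max_of_lt_left hK, fun M c hM hMc hcop => ?_⟩
  have hm0 : 0 < c - M := Nat.sub_pos_of_lt hMc
  have hsum : c - M + M = c := Nat.sub_add_cancel hMc.le
  have hcopm : Nat.Coprime (c - M) M := (Nat.coprime_sub_self_left hMc.le).mpr hcop.symm
  have habc : IsABCTriple (c - M) M c := ⟨hm0, hM, hsum, hcopm⟩
  have hc1 : (1 : ℝ) ≤ c := by exact_mod_cast (show 1 ≤ c by omega)
  have hc0 : (0 : ℝ) < c := by linarith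
  have hR1 : (1 : ℝ) ≤ ((rad 1 M c : ℕ) : ℝ) := one_le_rad 1 M c
  have hR0 : (0 : ℝ) ≤ ((rad 1 M c : ℕ) : ℝ) := by linarith
  have hRpow1 : (1 : ℝ) ≤ ((rad 1 M c : ℕ) : ℝ) ^ (1 + ε) := Real.one_le_rpow hR1 (by linarith)
  have hRpow0 : (0 : ℝ) ≤ ((rad 1 M c : ℕ) : ℝ) ^ (1 + ε) := by linarith
  have hm0' : (0 : ℝ) < ((c - M : ℕ) : ℝ) := by exact_mod_cast hm0
  have hmnn : (0 : ℝ) ≤ ((c - M : ℕ) : ℝ) := hm0'.le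
  by_cases hlop : (((c - M : ℕ) : ℝ)) ≤ (c : ℝ) ^ (1 - ε)
  · have hmin : ((min (c - M) M : ℕ) : ℝ) ≤ (c : ℝ) ^ (1 - ε) :=
      le_trans (by exact_mod_cast min_le_left (c - M) M) hlop
    have hlt := hh (c - M) M c habc hmin
    have hradle : ((rad (c - M) M c : ℕ) : ℝ) ≤ ((c - M : ℕ) : ℝ) * ((rad 1 M c : ℕ) : ℝ) := by
      exact_mod_cast rad_le_mul_rad_one hm0 M c
    have h1ε : (0 : ℝ) ≤ 1 + ε := by linarith
    have hstep1 : (c : ℝ) < K * (((c - M : ℕ) : ℝ) ^ (1 + ε) * ((rad 1 M c : ℕ) : ℝ) ^ (1 + ε)) := by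
      calc (c : ℝ) < K * ((rad (c - M) M c : ℕ) : ℝ) ^ (1 + ε) := hlt
        _ ≤ K * ((((c - M : ℕ) : ℝ) * ((rad 1 M c : ℕ) : ℝ)) ^ (1 + ε)) := by
            apply mul_le_mul_of_nonneg_left _ hK.le
            exact Real.rpow_le_rpow (Nat.cast_nonneg _) hradle h1ε
        _ = K * (((c - M : ℕ) : ℝ) ^ (1 + ε) * ((rad 1 M c : ℕ) : ℝ) ^ (1 + ε)) := by
            rw [Real.mul_rpow hmnn hR0]
    have hmε : ((c - M : ℕ) : ℝ) ^ (1 + ε) ≤ ((c - M : ℕ) : ℝ) * (c : ℝ) ^ ε := by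
      rw [Real.rpow_add hm0', Real.rpow_one]
      apply mul_le_mul_of_nonneg_left _ hmnn
      calc ((c - M : ℕ) : ℝ) ^ ε ≤ ((c : ℝ) ^ (1 - ε)) ^ ε := Real.rpow_le_rpow hmnn hlop hε.le
        _ = (c : ℝ) ^ ((1 - ε) * ε) := by rw [← Real.rpow_mul hc0.le]
        _ ≤ (c : ℝ) ^ ε := by
            apply Real.rpow_le_rpow_of_exponent_le hc1
            nlinarith [sq_nonneg ε]
    have hcε : (0 : ℝ) < (c : ℝ) ^ ε := Real.rpow_pos_of_pos hc0 ε
    have hstep2 : (c : ℝ) < K * ((c - M : ℕ) : ℝ) * ((rad 1 M c : ℕ) : ℝ) ^ (1 + ε) * (c : ℝ) ^ ε := by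
      calc (c : ℝ) < K * (((c - M : ℕ) : ℝ) ^ (1 + ε) * ((rad 1 M c : ℕ) : ℝ) ^ (1 + ε)) := hstep1
        _ ≤ K * ((((c - M : ℕ) : ℝ) * (c : ℝ) ^ ε) * ((rad 1 M c : ℕ) : ℝ) ^ (1 + ε)) := by
            apply mul_le_mul_of_nonneg_left _ hK.le
            exact mul_le_mul_of_nonneg_right hmε hRpow0
        _ = K * ((c - M : ℕ) : ℝ) * ((rad 1 M c : ℕ) : ℝ) ^ (1 + ε) * (c : ℝ) ^ ε := by ring
    have hstep3 : (c : ℝ) ^ (1 - ε) < K * ((c - M : ℕ) : ℝ) * ((rad 1 M c : ℕ) : ℝ) ^ (1 + ε) := by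
      rw [Real.rpow_sub hc0, Real.rpow_one, div_lt_iff₀ hcε]
      exact hstep2
    calc (c : ℝ) ^ (1 - ε) ≤ K * ((c - M : ℕ) : ℝ) * ((rad 1 M c : ℕ) : ℝ) ^ (1 + ε) := hstep3.le
      _ ≤ max K 1 * ((c - M : ℕ) : ℝ) * ((rad 1 M c : ℕ) : ℝ) ^ (1 + ε) :=
          mul_le_mul_of_nonneg_right (mul_le_mul_of_nonneg_right (le_max_left K 1) hmnn) hRpow0
  · replace hlop := not_le.mp hlop
    have hK1 : (0 : ℝ) ≤ max K 1 := le_trans zero_le_one (le_max_right K 1)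
    calc (c : ℝ) ^ (1 - ε) ≤ ((c - M : ℕ) : ℝ) := hlop.le
      _ = 1 * ((c - M : ℕ) : ℝ) * 1 := by ring
      _ ≤ max K 1 * ((c - M : ℕ) : ℝ) * ((rad 1 M c : ℕ) : ℝ) ^ (1 + ε) :=
          mul_le_mul (mul_le_mul_of_nonneg_right (le_max_right K 1) hmnn) hRpow1 zero_le_one
            (mul_nonneg hK1 hmnn)

/-! ### A2.  The archimedean shadow alone gives abc on the squarefree-min cell -/

/-- **A2.** `ArchShadow → SquarefreeMinABC`.  For a triple `(a ≤ b, c)` with `a` squarefree apply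
`ArchShadow` at `η = min(ε,1)/3` to `M = b`: `c^(1-η) ≤ K·a·rad(bc)^(1+η) ≤ K·rad(abc)^(1+η)`
(`rad(abc) = a·rad(bc)`), then take the `1/(1−η)`-th power: `(1+η)/(1−η) ≤ 1 + ε`. [folklore] -/
theorem squarefreeMin_of_archShadow (h : ArchShadow) : SquarefreeMinABC := by
  intro ε hε
  set η : ℝ := min ε 1 / 3 with hηdef
  have hmin0 : 0 < min ε 1 := lt_min hε one_pos
  have hη : 0 < η := by rw [hηdef]; positivity
  have hη3ε : 3 * η ≤ ε := by rw [hηdef]; linarith [min_le_left ε 1]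
  have hη31 : 3 * η ≤ 1 := by rw [hηdef]; linarith [min_le_right ε 1]
  have h1η : 0 < 1 - η := by linarith
  have hexp : 0 < 1 / (1 - η) := by positivity
  have hquot : (1 + η) * (1 / (1 - η)) ≤ 1 + ε := by
    rw [← div_eq_mul_one_div, div_le_iff₀ h1η]
    have h1 : ε * η ≤ ε * (1 / 3) := mul_le_mul_of_nonneg_left (by linarith) hε.le
    nlinarith [h1]
  obtain ⟨K, hK, hh⟩ := h η hη
  refine ⟨(K + 1) ^ (1 / (1 - η)), Real.rpow_pos_of_pos (by linarith) _, fun a b c habc hsq => ?_⟩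
  -- WLOG `a ≤ b`
  wlog hab : a ≤ b generalizing a b with H
  · have := H b a (isABCTriple_swap habc) (by rwa [min_comm]) (not_le.mp hab).le
    rwa [rad_swap'] at this
  rw [min_eq_left hab] at hsq
  have hrad : rad a b c = a * rad 1 b c := rad_eq_mul_rad_one_of_squarefree habc hsq
  obtain ⟨ha0, hb0, hsum, hcop⟩ := habc
  have hbc : b < c := by omega
  have hcopbc : Nat.Coprime b c := by rw [← hsum]; exact Nat.coprime_add_self_right.mpr hcop.symm
  have key := hh b c hb0 hbc hcopbc
  have hcb : c - b = a := by omega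
  rw [hcb] at key
  -- sizes
  have hc1 : (1 : ℝ) ≤ c := by exact_mod_cast (show 1 ≤ c by omega)
  have hc0 : (0 : ℝ) < c := by linarith
  have ha1 : (1 : ℝ) ≤ a := by exact_mod_cast ha0
  have ha0' : (0 : ℝ) ≤ a := by linarith
  have hR0 : (0 : ℝ) ≤ ((rad 1 b c : ℕ) : ℝ) := Nat.cast_nonneg _
  have hRR1 : (1 : ℝ) ≤ ((rad a b c : ℕ) : ℝ) := one_le_rad a b c
  have hRR0 : (0 : ℝ) ≤ ((rad a b c : ℕ) : ℝ) := by linarith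
  have h1η' : (0 : ℝ) ≤ 1 + η := by linarith
  -- `a · rad(bc)^(1+η) ≤ (a · rad(bc))^(1+η) = rad(abc)^(1+η)`
  have hmono : (a : ℝ) * ((rad 1 b c : ℕ) : ℝ) ^ (1 + η) ≤ ((rad a b c : ℕ) : ℝ) ^ (1 + η) := by
    have hcast : ((rad a b c : ℕ) : ℝ) = (a : ℝ) * ((rad 1 b c : ℕ) : ℝ) := by
      rw [hrad]; push_cast; ring
    rw [hcast, Real.mul_rpow ha0' hR0]
    apply mul_le_mul_of_nonneg_right _ (Real.rpow_nonneg hR0 _)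
    calc (a : ℝ) = (a : ℝ) ^ (1 : ℝ) := (Real.rpow_one _).symm
      _ ≤ (a : ℝ) ^ (1 + η) := Real.rpow_le_rpow_of_exponent_le ha1 (by linarith)
  have hstep : (c : ℝ) ^ (1 - η) < (K + 1) * ((rad a b c : ℕ) : ℝ) ^ (1 + η) := by
    calc (c : ℝ) ^ (1 - η) ≤ K * (a : ℝ) * ((rad 1 b c : ℕ) : ℝ) ^ (1 + η) := key
      _ = K * ((a : ℝ) * ((rad 1 b c : ℕ) : ℝ) ^ (1 + η)) := by ring
      _ ≤ K * ((rad a b c : ℕ) : ℝ) ^ (1 + η) := mul_le_mul_of_nonneg_left hmono hK.le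
      _ < (K + 1) * ((rad a b c : ℕ) : ℝ) ^ (1 + η) := by
          have : (0 : ℝ) < ((rad a b c : ℕ) : ℝ) ^ (1 + η) := by positivity
          nlinarith
  -- take the `1/(1-η)`-th power
  have hlhs0 : (0 : ℝ) ≤ (c : ℝ) ^ (1 - η) := (Real.rpow_pos_of_pos hc0 _).le
  have hpow := Real.rpow_lt_rpow hlhs0 hstep hexp
  rw [← Real.rpow_mul hc0.le, show (1 - η) * (1 / (1 - η)) = 1 by field_simp, Real.rpow_one,
    Real.mul_rpow (by linarith) (Real.rpow_nonneg hRR0 _), ← Real.rpow_mul hRR0] at hpow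
  calc (c : ℝ) < (K + 1) ^ (1 / (1 - η)) * ((rad a b c : ℕ) : ℝ) ^ ((1 + η) * (1 / (1 - η))) := hpow
    _ ≤ (K + 1) ^ (1 / (1 - η)) * ((rad a b c : ℕ) : ℝ) ^ (1 + ε) := by
        apply mul_le_mul_of_nonneg_left _ (Real.rpow_nonneg (by linarith) _)
        exact Real.rpow_le_rpow_of_exponent_le hRR1 hquot

/-- `SquarefreeMinABC → MinOneABC` (`1` is squarefree). [folklore] -/
theorem minOne_of_squarefreeMin (h : SquarefreeMinABC) : MinOneABC := by
  intro ε hε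
  obtain ⟨K, hK, hh⟩ := h ε hε
  exact ⟨K, hK, fun a b c habc h1 => hh a b c habc (by rw [h1]; exact squarefree_one)⟩

/-- The crux is a restriction of the summit. [folklore] -/
theorem lopsided_of_abc (h : _root_.ABC) : LopsidedABC := by
  intro ε hε
  obtain ⟨K, hK, hh⟩ := (ABC_iff.mp h) ε hε
  exact ⟨K, hK, fun a b c habc _ => hh a b c habc⟩

/-- **Sandwich.** `ABC → LopsidedABC → ArchShadow → SquarefreeMinABC → MinOneABC`:
the crux decides abc on the `a = 1` cell. [folklore] -/
theorem minOne_of_lopsided (h : LopsidedABC) : MinOneABC :=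
  minOne_of_squarefreeMin (squarefreeMin_of_archShadow (archShadow_of_lopsided h))

theorem squarefreeMin_of_lopsided (h : LopsidedABC) : SquarefreeMinABC :=
  squarefreeMin_of_archShadow (archShadow_of_lopsided h)

theorem archShadow_of_abc (h : _root_.ABC) : ArchShadow :=
  archShadow_of_lopsided (lopsided_of_abc h)


/-! ## §B  The powerful-min residual of `ArchShadow` is crux-complete (criterion (c) fails for D-A)

`SquareMinLopsided` is the crux restricted to lopsided triples whose smaller member AND whose `c` are
perfect squares — a sub-cell of the "powerful min" cell on which `ArchShadow` is silent.  One min-breeding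
`τ(a,b,c) = (a², b(a+c), c²)` (the s1 companion's `breed`) maps EVERY ordered lopsided triple into this cell,
preserving lopsidedness exactly and multiplying the radical by `≤ a + c ≤ 2c`; hence
`lopsided_of_squareMinLopsided : SquareMinLopsided → LopsidedABC` and the cell is crux-complete.  So the
candidate decomposition D-A = {`ArchShadow`, crux on powerful-min triples} has a piece that gives the crux on
its own: not an honest split. -/

/-- The crux restricted to lopsided triples with `min(a,b)` and `c` perfect squares. -/
def SquareMinLopsided : Prop :=
  ∀ ε : ℝ, 0 < ε → ∃ K : ℝ, 0 < K ∧ ∀ a b c : ℕ, IsABCTriple a b c →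
    (∃ x : ℕ, min a b = x ^ 2) → (∃ z : ℕ, c = z ^ 2) → ((min a b : ℕ) : ℝ) ≤ (c : ℝ) ^ (1 - ε) →
    (c : ℝ) < K * ((rad a b c : ℕ) : ℝ) ^ (1 + ε)

/-- Restriction. [folklore] -/
theorem squareMinLopsided_of_lopsided (h : LopsidedABC) : SquareMinLopsided := by
  intro ε hε
  obtain ⟨K, hK, hh⟩ := h ε hε
  exact ⟨K, hK, fun a b c habc _ _ hlop => hh a b c habc hlop⟩

/-- Min-breeding preserves abc triples: `a² + b(a+c) = c²`, `gcd(a², b(a+c)) = 1`. [folklore] -/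
theorem isABCTriple_breed {a b c : ℕ} (h : IsABCTriple a b c) :
    IsABCTriple (a ^ 2) (b * (a + c)) (c ^ 2) := by
  obtain ⟨ha, hb, hsum, hcop⟩ := h
  have hac : Nat.Coprime a c := by rw [← hsum]; exact Nat.coprime_self_add_right.mpr hcop
  have haac : Nat.Coprime a (a + c) := Nat.coprime_self_add_right.mpr hac
  refine ⟨by positivity, Nat.mul_pos hb (by omega), ?_, ?_⟩
  · subst hsum; ring
  · exact Nat.Coprime.pow_left 2 (Nat.Coprime.mul_right hcop haac)

/-- In an abc triple, `rad(abc) = rad(a)·rad(b)·rad(c)`. [folklore] -/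
theorem rad_eq_mul_mul {a b c : ℕ} (h : IsABCTriple a b c) :
    rad a b c = radical a * radical b * radical c := by
  obtain ⟨-, -, hsum, hcop⟩ := h
  have hac : Nat.Coprime a c := by rw [← hsum]; exact Nat.coprime_self_add_right.mpr hcop
  have hbc : Nat.Coprime b c := by rw [← hsum]; exact Nat.coprime_add_self_right.mpr hcop.symm
  have h1 : IsRelPrime (a * b) c := Nat.coprime_iff_isRelPrime.mp (Nat.Coprime.mul_left hac hbc)
  have h2 : IsRelPrime a b := Nat.coprime_iff_isRelPrime.mp hcop
  rw [rad_def, radical_mul h1, radical_mul h2]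

/-- **Breeding, radical**: `rad(a² · b(a+c) · c²) ≤ rad(abc) · (a + c)`. [folklore] -/
theorem rad_breed_le {a b c : ℕ} (h : IsABCTriple a b c) :
    rad (a ^ 2) (b * (a + c)) (c ^ 2) ≤ rad a b c * (a + c) := by
  have hpos : ∀ x y : ℕ, 0 < radical x * radical y := fun x y =>
    Nat.mul_pos (Nat.radical_pos _) (Nat.radical_pos _)
  have hac0 : a + c ≠ 0 := by obtain ⟨ha, -, -, -⟩ := h; omega
  rw [rad_eq_mul_mul h, rad_def]
  calc radical (a ^ 2 * (b * (a + c)) * c ^ 2)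
      ≤ radical (a ^ 2 * (b * (a + c))) * radical (c ^ 2) := Nat.le_of_dvd (hpos _ _) radical_mul_dvd
    _ ≤ radical (a ^ 2) * radical (b * (a + c)) * radical (c ^ 2) :=
        Nat.mul_le_mul_right _ (Nat.le_of_dvd (hpos _ _) radical_mul_dvd)
    _ ≤ radical (a ^ 2) * (radical b * radical (a + c)) * radical (c ^ 2) :=
        Nat.mul_le_mul_right _ (Nat.mul_le_mul_left _ (Nat.le_of_dvd (hpos _ _) radical_mul_dvd))
    _ ≤ radical (a ^ 2) * (radical b * (a + c)) * radical (c ^ 2) :=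
        Nat.mul_le_mul_right _ (Nat.mul_le_mul_left _
          (Nat.mul_le_mul_left _ (Nat.radical_le_self_iff.mpr hac0)))
    _ = radical a * radical b * radical c * (a + c) := by
        rw [radical_pow a two_ne_zero, radical_pow c two_ne_zero]; ring

/-- **Exponent bookkeeping**: from `c^(1-η) < L·R^(1+η)` with `0 < 3η ≤ min(ε,1)`, `R ≥ 1`, `L > 0`
deduce `c < L^(1/(1-η)) · R^(1+ε)`. [folklore] -/
theorem lt_of_rpow_one_sub_lt {c R L ε η : ℝ} (hc : 0 < c) (hR : 1 ≤ R) (hL : 0 < L) (hε : 0 < ε)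
    (hη : 0 < η) (hη3ε : 3 * η ≤ ε) (hη31 : 3 * η ≤ 1) (h : c ^ (1 - η) < L * R ^ (1 + η)) :
    c < L ^ (1 / (1 - η)) * R ^ (1 + ε) := by
  have h1η : 0 < 1 - η := by linarith
  have hexp : 0 < 1 / (1 - η) := by positivity
  have hquot : (1 + η) * (1 / (1 - η)) ≤ 1 + ε := by
    rw [← div_eq_mul_one_div, div_le_iff₀ h1η]
    have h1 : ε * η ≤ ε * (1 / 3) := mul_le_mul_of_nonneg_left (by linarith) hε.le
    nlinarith [h1]
  have hR0 : 0 ≤ R := by linarith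
  have hlhs0 : (0 : ℝ) ≤ c ^ (1 - η) := (Real.rpow_pos_of_pos hc _).le
  have hpow := Real.rpow_lt_rpow hlhs0 h hexp
  rw [← Real.rpow_mul hc.le, show (1 - η) * (1 / (1 - η)) = 1 by field_simp, Real.rpow_one,
    Real.mul_rpow hL.le (Real.rpow_nonneg hR0 _), ← Real.rpow_mul hR0] at hpow
  calc c < L ^ (1 / (1 - η)) * R ^ ((1 + η) * (1 / (1 - η))) := hpow
    _ ≤ L ^ (1 / (1 - η)) * R ^ (1 + ε) := by
        apply mul_le_mul_of_nonneg_left _ (Real.rpow_nonneg hL.le _)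
        exact Real.rpow_le_rpow_of_exponent_le hR hquot

/-- **B1.** The square-min cell is crux-complete: `SquareMinLopsided → LopsidedABC` (breed once). [folklore] -/
theorem lopsided_of_squareMinLopsided (h : SquareMinLopsided) : LopsidedABC := by
  intro ε hε
  set η : ℝ := min ε 1 / 3 with hηdef
  have hmin0 : 0 < min ε 1 := lt_min hε one_pos
  have hη : 0 < η := by rw [hηdef]; positivity
  have hη3ε : 3 * η ≤ ε := by rw [hηdef]; linarith [min_le_left ε 1]
  have hη31 : 3 * η ≤ 1 := by rw [hηdef]; linarith [min_le_right ε 1]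
  have hηε : η ≤ ε := by linarith
  obtain ⟨K, hK, hh⟩ := h η hη
  have hL : 0 < K * (2 : ℝ) ^ (1 + η) := by positivity
  refine ⟨(K * (2 : ℝ) ^ (1 + η)) ^ (1 / (1 - η)), Real.rpow_pos_of_pos hL _, fun a b c habc hlop => ?_⟩
  -- WLOG `a ≤ b`
  wlog hab : a ≤ b generalizing a b with H
  · have := H b a (isABCTriple_swap habc) (by rwa [min_comm]) (not_le.mp hab).le
    rwa [rad_swap'] at this
  rw [min_eq_left hab] at hlop
  have habc' := isABCTriple_breed habc
  have hradN := rad_breed_le habc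
  obtain ⟨ha, hb, hsum, hcop⟩ := habc
  -- sizes
  have hc1 : (1 : ℝ) ≤ c := by exact_mod_cast (show 1 ≤ c by omega)
  have hc0 : (0 : ℝ) < c := by linarith
  have ha0 : (0 : ℝ) ≤ a := Nat.cast_nonneg a
  have hR1 : (1 : ℝ) ≤ ((rad a b c : ℕ) : ℝ) := one_le_rad a b c
  have hR0 : (0 : ℝ) ≤ ((rad a b c : ℕ) : ℝ) := by linarith
  -- the bred triple is in the cell: min = a², c' = c²
  have hmin' : min (a ^ 2) (b * (a + c)) = a ^ 2 := by
    apply min_eq_left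
    calc a ^ 2 = a * a := sq a
      _ ≤ b * (a + c) := Nat.mul_le_mul hab (Nat.le_add_right a c)
  -- and lopsided at scale `η`
  have hlop' : ((min (a ^ 2) (b * (a + c)) : ℕ) : ℝ) ≤ (((c ^ 2 : ℕ) : ℕ) : ℝ) ^ (1 - η) := by
    rw [hmin']
    push_cast
    calc (a : ℝ) ^ 2 ≤ ((c : ℝ) ^ (1 - ε)) ^ 2 := pow_le_pow_left₀ ha0 hlop 2
      _ = (c : ℝ) ^ ((1 - ε) * 2) := by
          rw [Real.rpow_mul hc0.le, show ((2 : ℝ)) = ((2 : ℕ) : ℝ) by norm_num, Real.rpow_natCast]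
      _ ≤ (c : ℝ) ^ ((1 - η) * 2) := by
          apply Real.rpow_le_rpow_of_exponent_le hc1; linarith
      _ = ((c : ℝ) ^ 2) ^ (1 - η) := by
          rw [mul_comm, Real.rpow_mul hc0.le, show ((2 : ℝ)) = ((2 : ℕ) : ℝ) by norm_num,
            Real.rpow_natCast]
  have hlt := hh (a ^ 2) (b * (a + c)) (c ^ 2) habc' ⟨a, hmin'⟩ ⟨c, rfl⟩ hlop'
  -- radical bookkeeping: `rad' ≤ rad · (a + c) ≤ rad · 2c`
  have hradle : ((rad (a ^ 2) (b * (a + c)) (c ^ 2) : ℕ) : ℝ) ≤ ((rad a b c : ℕ) : ℝ) * (2 * (c : ℝ)) := by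
    have h2 : rad (a ^ 2) (b * (a + c)) (c ^ 2) ≤ rad a b c * (2 * c) :=
      hradN.trans (Nat.mul_le_mul_left _ (by omega))
    exact_mod_cast h2
  have h1η : (0 : ℝ) ≤ 1 + η := by linarith
  have hstep : ((c : ℝ) ^ 2) < K * (2 : ℝ) ^ (1 + η) * ((rad a b c : ℕ) : ℝ) ^ (1 + η) * (c : ℝ) ^ (1 + η) := by
    have hcast : (((c ^ 2 : ℕ) : ℕ) : ℝ) = (c : ℝ) ^ 2 := by push_cast; ring
    calc (c : ℝ) ^ 2 = (((c ^ 2 : ℕ) : ℕ) : ℝ) := hcast.symm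
      _ < K * ((rad (a ^ 2) (b * (a + c)) (c ^ 2) : ℕ) : ℝ) ^ (1 + η) := hlt
      _ ≤ K * ((((rad a b c : ℕ) : ℝ) * (2 * (c : ℝ))) ^ (1 + η)) := by
          apply mul_le_mul_of_nonneg_left _ hK.le
          exact Real.rpow_le_rpow (Nat.cast_nonneg _) hradle h1η
      _ = K * (2 : ℝ) ^ (1 + η) * ((rad a b c : ℕ) : ℝ) ^ (1 + η) * (c : ℝ) ^ (1 + η) := by
          rw [Real.mul_rpow hR0 (by positivity), Real.mul_rpow (by norm_num) hc0.le]; ring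
  -- divide by `c^(1+η)`: `c^(1-η) < (K·2^(1+η)) · rad^(1+η)`
  have hcpow : (0 : ℝ) < (c : ℝ) ^ (1 + η) := Real.rpow_pos_of_pos hc0 _
  have hstep2 : (c : ℝ) ^ (1 - η) < K * (2 : ℝ) ^ (1 + η) * ((rad a b c : ℕ) : ℝ) ^ (1 + η) := by
    have hsub : (1 - η : ℝ) = 2 - (1 + η) := by ring
    rw [hsub, Real.rpow_sub hc0, show ((2 : ℝ)) = ((2 : ℕ) : ℝ) by norm_num, Real.rpow_natCast,
      div_lt_iff₀ hcpow]
    exact_mod_cast hstep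
  exact lt_of_rpow_one_sub_lt hc0 hR1 hL hε hη hη3ε hη31 hstep2

/-- The square-min cell is EQUIVALENT to the crux. [folklore] -/
theorem squareMinLopsided_iff_lopsided : SquareMinLopsided ↔ LopsidedABC :=
  ⟨lopsided_of_squareMinLopsided, squareMinLopsided_of_lopsided⟩


/-! ## §D  A radical-controlled breeding that MOVES THE TOP: `ρ(a, b, c) = (a², c·(b − a), b²)`

All breedings used so far (`σ`: pair squaring, `τ`: min squaring, power maps) send `c ↦ cⁿ`, which is why the
s1 census (D3/D4) treats `supp(c)`-profile cells (`CDominated` / `CDispersed`, `ω(c)`, squarefree-`c`) as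
breeding-invariant.  They are not: for `a < b` the identity `a² + (a + b)(b − a) = b²` is an abc triple
`ρ(a,b,c) = (a², c(b−a), b²)` with the OLD MIDDLE MEMBER `b` on top, `min = a²` (share preserved up to
`log b / log c → 1` on lopsided data) and `rad(ρ) ≤ rad(abc)·(b − a) < rad(abc)·c`.  So a `c`-dispersed but
`b`-dominated lopsided triple is bred into the `c`-dominated cell at the usual cost `c^(O(ε))`: the honest core of
D3 shrinks to "BOTH large members dispersed", and the only cell coordinates invariant under the whole breeding
semigroup `⟨σ, τ, ρ, powers⟩` are symmetric functions of the `{b, c}` prime-power profiles (census r1 §Decomposition). -/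

/-- `ρ` preserves abc triples: `a² + c(b − a) = b²`, `gcd(a², c(b−a)) = 1` (for `a < b`). [folklore] -/
theorem isABCTriple_rho {a b c : ℕ} (h : IsABCTriple a b c) (hab : a < b) :
    IsABCTriple (a ^ 2) (c * (b - a)) (b ^ 2) := by
  obtain ⟨ha, hb, hsum, hcop⟩ := h
  have hac : Nat.Coprime a c := by rw [← hsum]; exact Nat.coprime_self_add_right.mpr hcop
  have haba : Nat.Coprime a (b - a) := (Nat.coprime_sub_self_right hab.le).mpr hcop
  refine ⟨by positivity, Nat.mul_pos (by omega) (by omega), ?_, ?_⟩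
  · have h1 : c * (b - a) = b ^ 2 - a ^ 2 := by rw [Nat.sq_sub_sq b a, ← hsum, add_comm]
    have h2 : a ^ 2 ≤ b ^ 2 := Nat.pow_le_pow_left hab.le 2
    omega
  · exact Nat.Coprime.pow_left 2 (Nat.Coprime.mul_right hac haba)

/-- **`ρ`, radical**: `rad(a² · c(b−a) · b²) ≤ rad(abc) · (b − a)`. [folklore] -/
theorem rad_rho_le {a b c : ℕ} (h : IsABCTriple a b c) (hab : a < b) :
    rad (a ^ 2) (c * (b - a)) (b ^ 2) ≤ rad a b c * (b - a) := by
  have hpos : ∀ x y : ℕ, 0 < radical x * radical y := fun x y =>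
    Nat.mul_pos (Nat.radical_pos _) (Nat.radical_pos _)
  have hba0 : b - a ≠ 0 := by omega
  rw [rad_eq_mul_mul h, rad_def]
  calc radical (a ^ 2 * (c * (b - a)) * b ^ 2)
      ≤ radical (a ^ 2 * (c * (b - a))) * radical (b ^ 2) := Nat.le_of_dvd (hpos _ _) radical_mul_dvd
    _ ≤ radical (a ^ 2) * radical (c * (b - a)) * radical (b ^ 2) :=
        Nat.mul_le_mul_right _ (Nat.le_of_dvd (hpos _ _) radical_mul_dvd)
    _ ≤ radical (a ^ 2) * (radical c * radical (b - a)) * radical (b ^ 2) :=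
        Nat.mul_le_mul_right _ (Nat.mul_le_mul_left _ (Nat.le_of_dvd (hpos _ _) radical_mul_dvd))
    _ ≤ radical (a ^ 2) * (radical c * (b - a)) * radical (b ^ 2) :=
        Nat.mul_le_mul_right _ (Nat.mul_le_mul_left _
          (Nat.mul_le_mul_left _ (Nat.radical_le_self_iff.mpr hba0)))
    _ = radical a * radical b * radical c * (b - a) := by
        rw [radical_pow a two_ne_zero, radical_pow b two_ne_zero]; ring

/-- The bred minimum is `a²` as soon as `a² ≤ c`, in particular for every lopsided triple with `ε ≥ 1/2`…;
in general `min(ρ) ≤ a²`, so the share can only go UP: `min(ρ) ≤ a² ≤ (c^(1-ε))² ≤ (b²)^(1-ε) · (c/b)^2`.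
We record the clean special case used in the census: if `a ≤ c^(1-ε)` and `a ^ 2 ≤ c * (b - a)` then
`min(ρ) = a²`. [folklore] -/
theorem min_rho_eq {a b c : ℕ} (h : a ^ 2 ≤ c * (b - a)) : min (a ^ 2) (c * (b - a)) = a ^ 2 :=
  min_eq_left h

/-! ## §C  Calibration: Erdős's consecutive powerful numbers -/

/-- `n` is POWERFUL (squarefull): `p ∣ n ⇒ p² ∣ n` for every prime `p`.  Literally
`Literature.NumberTheory.DiophantineGeometry.IsPowerful 2 n` (`SquarefulSums.lean`, `isPowerful_iff`),
restated so that this file imports only the route file. [folklore] -/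
def Powerful (n : ℕ) : Prop := ∀ p ∈ n.primeFactors, p ^ 2 ∣ n

/-- For a powerful positive `n`, `rad(n)² ≤ n`. [folklore] -/
theorem radical_sq_le_of_powerful {n : ℕ} (hn : n ≠ 0) (h : Powerful n) :
    radical n ^ 2 ≤ n := by
  rw [Nat.radical_eq_prod_primeFactors, ← Finset.prod_pow]
  apply Nat.le_of_dvd (Nat.pos_of_ne_zero hn)
  -- `∏ p², p ∈ primeFactors n` divides `n = ∏ p ^ v_p(n)`
  have hfac : ∏ p ∈ n.primeFactors, p ^ n.factorization p = n := by
    rw [← Nat.support_factorization]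
    exact Nat.prod_factorization_pow_eq_self hn
  conv_rhs => rw [← hfac]
  apply Finset.prod_dvd_prod_of_dvd
  intro p hp
  apply pow_dvd_pow
  have hpp : p.Prime := Nat.prime_of_mem_primeFactors hp
  exact (hpp.pow_dvd_iff_le_factorization hn).mp (h p hp)

/-- The set of `n ≥ 2` with `n − 1, n, n + 1` all powerful. -/
def erdosPowerfulTriples : Set ℕ :=
  {n : ℕ | 2 ≤ n ∧ Powerful (n - 1) ∧ Powerful n ∧ Powerful (n + 1)}

/-- **C1.** abc on the `a = 1` cell ⟹ only finitely many `n` with `n−1, n, n+1` all powerful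
(use the triple `(1, n² − 1, n²)`, `rad ≤ n^(3/2)`, at `ε = 1/7`).  Hence (§A) the crux `LopsidedABC`
implies it. [folklore] -/
theorem erdosPowerfulTriples_finite_of_minOne (h : MinOneABC) : erdosPowerfulTriples.Finite := by
  obtain ⟨K, hK, hh⟩ := h (1 / 7) (by norm_num)
  -- every member satisfies `n^(2/7) < K`, hence `n < N` for a fixed `N`
  obtain ⟨N, hN⟩ : ∃ N : ℕ, K ^ (7 / 2 : ℝ) < N := exists_nat_gt _
  refine (Set.finite_Iio N).subset ?_
  intro n hn
  obtain ⟨hn2, hpm, hp0, hpp⟩ := hn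
  rw [Set.mem_Iio]
  -- the abc triple `(1, n² − 1, n²)`
  have hn0 : n ≠ 0 := by omega
  have h4 : 4 ≤ n ^ 2 := by nlinarith
  have habc : IsABCTriple 1 (n ^ 2 - 1) (n ^ 2) :=
    ⟨one_pos, by omega, by omega, Nat.coprime_one_left _⟩
  have hlt := hh 1 (n ^ 2 - 1) (n ^ 2) habc (min_eq_left (by omega))
  -- radical bound: `rad(1·(n²−1)·n²) ≤ rad(n−1)·rad(n+1)·rad(n)` and each `rad(k)² ≤ k`
  have hfactor : n ^ 2 - 1 = (n - 1) * (n + 1) := by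
    rw [mul_comm, ← Nat.sq_sub_sq n 1, one_pow]
  have hradn : radical (1 * (n ^ 2 - 1) * n ^ 2) ≤ radical (n - 1) * radical (n + 1) * radical n := by
    rw [one_mul, hfactor]
    have hpos : ∀ x y : ℕ, 0 < radical x * radical y := fun x y =>
      Nat.mul_pos (Nat.radical_pos _) (Nat.radical_pos _)
    calc radical ((n - 1) * (n + 1) * n ^ 2)
        ≤ radical ((n - 1) * (n + 1)) * radical (n ^ 2) := Nat.le_of_dvd (hpos _ _) radical_mul_dvd
      _ ≤ radical (n - 1) * radical (n + 1) * radical (n ^ 2) :=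
          Nat.mul_le_mul_right _ (Nat.le_of_dvd (hpos _ _) radical_mul_dvd)
      _ = radical (n - 1) * radical (n + 1) * radical n := by rw [radical_pow n two_ne_zero]
  have hsq : (radical (n - 1) * radical (n + 1) * radical n) ^ 2 ≤ (n - 1) * (n + 1) * n := by
    rw [mul_pow, mul_pow]
    exact Nat.mul_le_mul (Nat.mul_le_mul (radical_sq_le_of_powerful (by omega) hpm)
      (radical_sq_le_of_powerful (by omega) hpp)) (radical_sq_le_of_powerful hn0 hp0)
  have hsq' : (rad 1 (n ^ 2 - 1) (n ^ 2)) ^ 2 ≤ n ^ 3 := by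
    rw [rad_def]
    calc (radical (1 * (n ^ 2 - 1) * n ^ 2)) ^ 2 ≤ (radical (n - 1) * radical (n + 1) * radical n) ^ 2 :=
          Nat.pow_le_pow_left hradn 2
      _ ≤ (n - 1) * (n + 1) * n := hsq
      _ = (n ^ 2 - 1) * n := by rw [hfactor]
      _ ≤ n ^ 2 * n := Nat.mul_le_mul_right n (Nat.sub_le _ _)
      _ = n ^ 3 := by ring
  -- pass to the reals: `R ≤ n^(3/2)`, `n² < K · R^(8/7) ≤ K · n^(12/7)`, so `n^(2/7) < K`
  have hn1 : (1 : ℝ) ≤ n := by exact_mod_cast (show 1 ≤ n by omega)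
  have hnpos : (0 : ℝ) < n := by linarith
  have hR0 : (0 : ℝ) ≤ ((rad 1 (n ^ 2 - 1) (n ^ 2) : ℕ) : ℝ) := Nat.cast_nonneg _
  have hRle : ((rad 1 (n ^ 2 - 1) (n ^ 2) : ℕ) : ℝ) ≤ (n : ℝ) ^ (3 / 2 : ℝ) := by
    have h2 : (((rad 1 (n ^ 2 - 1) (n ^ 2) : ℕ) : ℝ)) ^ (2 : ℝ) ≤ ((n : ℝ) ^ (3 / 2 : ℝ)) ^ (2 : ℝ) := by
      rw [← Real.rpow_mul hnpos.le, show (3 / 2 : ℝ) * 2 = (3 : ℕ) by norm_num, Real.rpow_natCast,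
        show (2 : ℝ) = (2 : ℕ) by norm_num, Real.rpow_natCast]
      exact_mod_cast hsq'
    exact (Real.rpow_le_rpow_iff hR0 (Real.rpow_nonneg hnpos.le _) two_pos).mp h2
  have hc : (((n ^ 2 : ℕ) : ℕ) : ℝ) = (n : ℝ) ^ (2 : ℝ) := by
    push_cast; rw [show (2 : ℝ) = (2 : ℕ) by norm_num, Real.rpow_natCast]
  have h87 : (0 : ℝ) ≤ (1 + 1 / 7 : ℝ) := by norm_num
  have hmain : (n : ℝ) ^ (2 : ℝ) < K * (n : ℝ) ^ (12 / 7 : ℝ) := by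
    calc (n : ℝ) ^ (2 : ℝ) = (((n ^ 2 : ℕ) : ℕ) : ℝ) := hc.symm
      _ < K * ((rad 1 (n ^ 2 - 1) (n ^ 2) : ℕ) : ℝ) ^ (1 + 1 / 7 : ℝ) := hlt
      _ ≤ K * ((n : ℝ) ^ (3 / 2 : ℝ)) ^ (1 + 1 / 7 : ℝ) := by
          apply mul_le_mul_of_nonneg_left _ hK.le
          exact Real.rpow_le_rpow hR0 hRle h87
      _ = K * (n : ℝ) ^ (12 / 7 : ℝ) := by
          rw [← Real.rpow_mul hnpos.le]; norm_num
  have h127 : (0 : ℝ) < (n : ℝ) ^ (12 / 7 : ℝ) := Real.rpow_pos_of_pos hnpos _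
  have h27 : (n : ℝ) ^ (2 / 7 : ℝ) < K := by
    rw [show (2 / 7 : ℝ) = 2 - 12 / 7 by norm_num, Real.rpow_sub hnpos, div_lt_iff₀ h127]
    exact hmain
  have hn27 : (0 : ℝ) ≤ (n : ℝ) ^ (2 / 7 : ℝ) := Real.rpow_nonneg hnpos.le _
  have h72 : (0 : ℝ) < (7 / 2 : ℝ) := by norm_num
  have hfin : (n : ℝ) < K ^ (7 / 2 : ℝ) := by
    have := Real.rpow_lt_rpow hn27 h27 h72
    rwa [← Real.rpow_mul hnpos.le, show (2 / 7 : ℝ) * (7 / 2) = 1 by norm_num, Real.rpow_one] at this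
  exact_mod_cast hfin.trans hN

/-- **C2.** The crux implies finiteness of Erdős's powerful triples. [folklore] -/
theorem erdosPowerfulTriples_finite_of_lopsided (h : LopsidedABC) : erdosPowerfulTriples.Finite :=
  erdosPowerfulTriples_finite_of_minOne (minOne_of_lopsided h)


/-! ## §E  The fixed-share ladder `X^(s₀)` between the crux and the `a = 1` cell

`FixedShareABC s₀` := abc with exponent `1 + ε` for EVERY `ε` on the FIXED cell `min(a,b) ≤ c^(1 − s₀)`.
`LopsidedABC ⟺ ∀ s₀ > 0, FixedShareABC s₀` (`fixedShare_of_lopsided`, `lopsided_of_forall_fixedShare`), the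
pieces get WEAKER as `s₀` grows (domain inclusion, `fixedShare_mono`), and `FixedShareABC 1` is abc on
`min(a,b) ≤ 1`, i.e. `MinOneABC` (`minOne_of_fixedShare_one`).  So the content of the crux sits at the LOW-share
end `s₀ → 0` (triples just inside the lopsided window, next to the balanced regime that `SexticABC` owns), not at
the ultra-lopsided end where the record qualities live; every window `[ε, s₀)` is crux-complete by σ-pumping
(s1 census D2), so the ladder does not split the crux either (census r1 §Decomposition D9). -/

/-- abc with exponent `1+ε` for all `ε` on the fixed cell `min(a,b) ≤ c^(1-s₀)`. -/
def FixedShareABC (s₀ : ℝ) : Prop :=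
  ∀ ε : ℝ, 0 < ε → ∃ K : ℝ, 0 < K ∧ ∀ a b c : ℕ, IsABCTriple a b c →
    ((min a b : ℕ) : ℝ) ≤ (c : ℝ) ^ (1 - s₀) → (c : ℝ) < K * ((rad a b c : ℕ) : ℝ) ^ (1 + ε)

/-- The ladder is monotone: a larger threshold is a smaller cell. [folklore] -/
theorem fixedShare_mono {s₀ s₁ : ℝ} (hs : s₀ ≤ s₁) (h : FixedShareABC s₀) : FixedShareABC s₁ := by
  intro ε hε
  obtain ⟨K, hK, hh⟩ := h ε hε
  refine ⟨K, hK, fun a b c habc hmin => hh a b c habc (hmin.trans ?_)⟩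
  have hc1 : (1 : ℝ) ≤ c := by obtain ⟨ha, hb, hsum, -⟩ := habc; exact_mod_cast (show 1 ≤ c by omega)
  exact Real.rpow_le_rpow_of_exponent_le hc1 (by linarith)

/-- **E1.** The crux gives every rung. [folklore] -/
theorem fixedShare_of_lopsided (h : LopsidedABC) {s₀ : ℝ} (hs₀ : 0 < s₀) : FixedShareABC s₀ := by
  intro ε hε
  rcases le_or_gt ε s₀ with hle | hlt
  · -- `ε ≤ s₀`: the cell `min ≤ c^(1-s₀)` lies inside `min ≤ c^(1-ε)`
    obtain ⟨K, hK, hh⟩ := h ε hε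
    refine ⟨K, hK, fun a b c habc hmin => hh a b c habc (hmin.trans ?_)⟩
    have hc1 : (1 : ℝ) ≤ c := by obtain ⟨ha, hb, hsum, -⟩ := habc; exact_mod_cast (show 1 ≤ c by omega)
    exact Real.rpow_le_rpow_of_exponent_le hc1 (by linarith)
  · -- `s₀ < ε`: use the crux at `s₀` and `rad^(1+s₀) ≤ rad^(1+ε)`
    obtain ⟨K, hK, hh⟩ := h s₀ hs₀
    refine ⟨K, hK, fun a b c habc hmin => (hh a b c habc hmin).trans_le ?_⟩
    apply mul_le_mul_of_nonneg_left _ hK.le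
    exact Real.rpow_le_rpow_of_exponent_le (one_le_rad a b c) (by linarith)

/-- **E2.** All rungs together give the crux back (take `s₀ = ε`). [folklore] -/
theorem lopsided_of_forall_fixedShare (h : ∀ s₀ : ℝ, 0 < s₀ → FixedShareABC s₀) : LopsidedABC :=
  fun ε hε => h ε hε ε hε

theorem lopsided_iff_forall_fixedShare : LopsidedABC ↔ ∀ s₀ : ℝ, 0 < s₀ → FixedShareABC s₀ :=
  ⟨fun h _ hs₀ => fixedShare_of_lopsided h hs₀, lopsided_of_forall_fixedShare⟩

/-- **E3.** The top rung is the `a = 1` cell: `FixedShareABC 1 → MinOneABC`. [folklore] -/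
theorem minOne_of_fixedShare_one (h : FixedShareABC 1) : MinOneABC := by
  intro ε hε
  obtain ⟨K, hK, hh⟩ := h ε hε
  refine ⟨K, hK, fun a b c habc h1 => hh a b c habc ?_⟩
  rw [h1, sub_self, Real.rpow_zero]; simp

/-- … and conversely `MinOneABC → FixedShareABC 1` (on an abc triple `min ≤ c^0 = 1` forces `min = 1`). [folklore] -/
theorem fixedShare_one_of_minOne (h : MinOneABC) : FixedShareABC 1 := by
  intro ε hε
  obtain ⟨K, hK, hh⟩ := h ε hε
  refine ⟨K, hK, fun a b c habc hmin => hh a b c habc ?_⟩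
  rw [sub_self, Real.rpow_zero] at hmin
  obtain ⟨ha, hb, -, -⟩ := habc
  have h1 : 1 ≤ min a b := le_min ha hb
  have h2 : (min a b : ℕ) ≤ 1 := by exact_mod_cast hmin
  omega


/-! ## §F  The route's two cruxes are JOINTLY summit-equivalent: `ABC ⟺ LopsidedABC ∧ SexticABC`

The only theorem relating the crux to the summit is the conjunct split itself: `closes` (route file) gives
`LopsidedABC → SexticABC → ABC`, and conversely `ABC` gives both conjuncts (`lopsided_of_abc`; `sextic_of_abc`:
`abc⁴ ≤ c⁶ < K⁶·rad^(6+ε)` from abc at `ε/6`).  So the pair is exactly the summit, and by the tribunal's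
conjunct-split rule one conjunct must be the NAMED attack and the other a declared residual; neither conjunct
alone is shown `≥ ABC` (census r1 §0). -/

/-- `ABC → SexticABC` (abc at `ε/6`, then `a·b·c⁴ ≤ c⁶`). [folklore] -/
theorem sextic_of_abc (h : _root_.ABC) : SexticABC := by
  intro ε hε
  obtain ⟨K, hK, hh⟩ := (ABC_iff.mp h) (ε / 6) (by positivity)
  refine ⟨K ^ (6 : ℕ), by positivity, fun a b c habc => ?_⟩
  have hlt := hh a b c habc
  obtain ⟨ha, hb, hsum, -⟩ := habc
  have hR0 : (0 : ℝ) ≤ ((rad a b c : ℕ) : ℝ) := Nat.cast_nonneg _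
  have hc0 : (0 : ℝ) ≤ (c : ℝ) := Nat.cast_nonneg _
  have hmono : ((a * b * c ^ 4 : ℕ) : ℝ) ≤ (c : ℝ) ^ (6 : ℕ) := by
    have h1 : a * b * c ^ 4 ≤ c * c * c ^ 4 := Nat.mul_le_mul_right _ (Nat.mul_le_mul (by omega) (by omega))
    have h2 : c * c * c ^ 4 = c ^ 6 := by ring
    exact_mod_cast (h2 ▸ h1)
  calc ((a * b * c ^ 4 : ℕ) : ℝ) ≤ (c : ℝ) ^ (6 : ℕ) := hmono
    _ < (K * ((rad a b c : ℕ) : ℝ) ^ (1 + ε / 6)) ^ (6 : ℕ) := pow_lt_pow_left₀ hlt hc0 (by norm_num)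
    _ = K ^ (6 : ℕ) * ((rad a b c : ℕ) : ℝ) ^ (6 + ε) := by
        rw [mul_pow, ← Real.rpow_natCast (((rad a b c : ℕ) : ℝ) ^ (1 + ε / 6)) 6, ← Real.rpow_mul hR0]
        norm_num; left; ring

/-- **F1.** The conjunct split is exact. [folklore] -/
theorem abc_iff_lopsided_and_sextic : _root_.ABC ↔ (LopsidedABC ∧ SexticABC) :=
  ⟨fun h => ⟨lopsided_of_abc h, sextic_of_abc h⟩, fun h => closes h.1 h.2⟩

end Summit.ABC.ABC.Cruxes.LopsidedABC.StrategistR1
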